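import Mathlib
import HarnessLib
import Literature.Analysis.FluidPDE.SelfSimilar
import Literature.Analysis.FluidPDE.LocalTypeI
import Literature.Analysis.FluidPDE.VectorCalculus
import Literature.Analysis.UnboundedOperators.HeatKernel
import Summits.NavierStokesRegularity.NavierStokesRegularity.Theorems.LocalSineTubeDoorProfileAlignedWindowRigidityAncient
import Summits.NavierStokesRegularity.NavierStokesRegularity.Theorems.PoloidalWindowDoorPoloidalWindowRigidityOneSlice
import Summits.NavierStokesRegularity.NavierStokesRegularity.Theorems.PoloidalWindowDoorPoloidalWindowRigidityFlat
import Summits.NavierStokesRegularity.NavierStokesRegularity.Theorems.PoloidalWindowDoorPoloidalWindowRigiditySimilarity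
import Summits.NavierStokesRegularity.NavierStokesRegularity.Theorems.PoloidalWindowDoorPoloidalWindowRigidityZoomOut
import Summits.NavierStokesRegularity.NavierStokesRegularity.Theorems.PoloidalWindowDoorPoloidalWindowRigidityConfined

/-!
# Route `PoloidalWindowDoor`, crux `PoloidalWindowRigidity` (K2, stmt-NavierStokesRegularity-19708) —
# THE ONE-DIRECTION DOOR AT `t = −∞` FOR PROFILES (mechanism «zoom-out symmetry gain», third application)

Cell ns-regularity-ideate, seat ns-poloidal-K2-p2 (stub-worker; lands `--supports` the crux, `--as helper`).  For the
WHOLE route class `𝔓(C)` (Type-I rate, continuous on the open slab, unit-viscosity Oseen-mild between negative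
times, divergence-free slices — no poloidality): the scale-invariant directional derivative `(−t)‖∂ₑv(t)‖_∞`
(`≤ C₁` on the class, tree `…ClassRate`) cannot tend to zero backward in time unless `v ≡ 0`.

* `fderiv_zoom_apply` — the directional derivative of a recentred zoom: `D(c v(σ, x₀ + c·))(y)[e] = c² Dv(σ)(x₀ + c y)[e]`;
* `tendsto_zero_of_directionalDerivative` — if `∀ ε > 0 ∃ T ∀ t < T ∀ x, (−t)‖Dv(t)(x)[e]‖ ≤ ε` (`e ≠ 0`), then
  `sup_x √(−t)‖v(t,x)‖ → 0` as `t → −∞`: the zoom-out limit at bad points (`…Confined.exists_zoomOut_limit`) is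
  invariant under the translations along `e` (mean value inequality along `e`, the bound being scale-invariant),
  hence zero (tree `eq_zero_of_translate_eq`) — contradiction;
* `eq_zero_of_directionalDerivative_tendsto_zero` / `nonflatLiouville_of_directionalDerivative_tendsto_zero` — so
  such a profile is trivial (`…ZoomOut.eq_zero_of_tendsto_zero`).  The one-slice translation stratum
  (`…OneSlice.eq_zero_of_translate_eq_slice`: `∂ₑv(s) ≡ 0` on ONE slice) is the case `ε = 0`; this is its
  ASYMPTOTIC form at `t = −∞` (compare the one-direction DOORS at the blow-up time of route LocalSineTubeDoor,
  `…OneDirection`, which live at `t → T⁻`).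

Reading for the residue of K2: a nontrivial profile keeps, for EVERY direction `e`, a definite scale-invariant
amount of `e`-dependence along a sequence of times `t → −∞` (it does not become two-dimensional in the past).

WHAT THIS IS NOT: not a claim about Navier–Stokes regularity and not the open residue — a settled asymptotic stratum,
whole Type-I class (bears_on LADDER-NS N0, rung N0-LocalTubeDoorPoloidal).
-/

noncomputable section

-- the summit and its single sub-problem share the name (CONVENTIONS §1), as in every Theorems file
set_option linter.dupNamespace false

namespace Summit.NavierStokesRegularity.NavierStokesRegularity.Theorems.PoloidalWindowDoorPoloidalWindowRigidityOneDirectionPast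

open MeasureTheory Set Function Filter Topology TopologicalSpace Metric
open scoped RealInnerProductSpace InnerProductSpace
open Literature.Analysis Literature.Analysis.FluidPDE
open Summit.NavierStokesRegularity.NavierStokesRegularity.Theorems.LocalSineTubeDoorProfileAlignedWindowRigidity
open Summit.NavierStokesRegularity.NavierStokesRegularity.Theorems.LocalSineTubeDoorProfileAlignedWindowRigidityAncient
open Summit.NavierStokesRegularity.NavierStokesRegularity.Theorems.PoloidalWindowDoorPoloidalWindowRigiditySimilarity
open Summit.NavierStokesRegularity.NavierStokesRegularity.Theorems.PoloidalWindowDoorPoloidalWindowRigidityZoomOut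
open Summit.NavierStokesRegularity.NavierStokesRegularity.Theorems.PoloidalWindowDoorPoloidalWindowRigidityConfined

variable {C : ℝ} {v : ℝ → EuclideanSpace ℝ (Fin 3) → EuclideanSpace ℝ (Fin 3)}

/-- **Directional derivative of a recentred zoom**: for `V` differentiable, `c ∈ ℝ`, `x₀, y, e`,
`D(y ↦ c V(x₀ + c y))(y)[e] = c² • DV(x₀ + c y)[e]`. -/
theorem fderiv_zoom_apply {V : EuclideanSpace ℝ (Fin 3) → EuclideanSpace ℝ (Fin 3)} (hV : Differentiable ℝ V)
    (c : ℝ) (x₀ y e : EuclideanSpace ℝ (Fin 3)) :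
    fderiv ℝ (fun w => c • V (x₀ + c • w)) y e = c ^ 2 • fderiv ℝ V (x₀ + c • y) e := by
  have hd : DifferentiableAt ℝ (fun w => V (x₀ + c • w)) y :=
    (hV (x₀ + c • y)).comp y ((differentiableAt_id.const_smul c).const_add x₀)
  have h1 : fderiv ℝ (fun w => c • V (x₀ + c • w)) y = c • fderiv ℝ (fun w => V (x₀ + c • w)) y :=
    fderiv_const_smul hd c
  rw [h1, fderiv_comp_homothety hV c x₀ y, smul_smul, ← sq]
  rfl

/-- **Asymptotically two-dimensional at `−∞` ⇒ small at `−∞`.** If for some `e ≠ 0` the scale-invariant directional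
derivative tends to zero backward in time, `∀ ε > 0 ∃ T ∀ t < T ∀ x, (−t)‖Dv(t)(x)[e]‖ ≤ ε`, then
`sup_x √(−t)‖v(t,x)‖ → 0` as `t → −∞`. -/
theorem tendsto_zero_of_directionalDerivative (hrate : HasTypeITimeDecay C v)
    (hcont : ContinuousOn (uncurry v) (Iio (0 : ℝ) ×ˢ univ))
    (hmild : ∀ s t : ℝ, s < t → t < 0 → ∀ x,
      v t x = UnboundedOperators.heatExtension (v s) (t - s) x - oseenDuhamel 1 s v v t x)
    (hdiv : ∀ t < 0, VectorCalculus.IsDivFree (v t)) {e : EuclideanSpace ℝ (Fin 3)} (he : e ≠ 0)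
    (hdir : ∀ ε : ℝ, 0 < ε → ∃ T : ℝ, ∀ t < T, ∀ x, (-t) * ‖fderiv ℝ (v t) x e‖ ≤ ε) :
    ∀ ε : ℝ, 0 < ε → ∃ T : ℝ, T < 0 ∧ ∀ t < T, ∀ x, Real.sqrt (-t) * ‖v t x‖ ≤ ε := by
  intro ε hε
  by_contra hcon
  push Not at hcon
  -- a bad sequence `t_k < −(k+1)`, `x_k`
  have hch : ∀ k : ℕ, ∃ t : ℝ, t < -((k : ℝ) + 1) ∧ ∃ x, ε < Real.sqrt (-t) * ‖v t x‖ := fun k =>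
    hcon _ (by have : (0 : ℝ) ≤ k := Nat.cast_nonneg k; linarith)
  choose tk htk xk hxk using hch
  have htk0 : ∀ k, tk k < 0 := fun k => by
    have := htk k; have : (0 : ℝ) ≤ k := Nat.cast_nonneg k; linarith
  set c : ℕ → ℝ := fun k => Real.sqrt (-tk k) with hcdef
  have hc0 : ∀ k, 0 < c k := fun k => Real.sqrt_pos.2 (neg_pos.2 (htk0 k))
  have hc2 : ∀ k, c k ^ 2 = -tk k := fun k => Real.sq_sqrt (neg_pos.2 (htk0 k)).le
  have hcinf : Tendsto c atTop atTop := by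
    have h1 : Tendsto (fun k : ℕ => Real.sqrt ((k : ℝ) + 1)) atTop atTop :=
      Real.tendsto_sqrt_atTop.comp (tendsto_natCast_atTop_atTop.atTop_add tendsto_const_nhds)
    refine tendsto_atTop_mono (fun k => ?_) h1
    exact Real.sqrt_le_sqrt (by have := htk k; linarith)
  -- the zoom-out limit at the bad points
  obtain ⟨φ, W, hφ, hWrate, hWc, hWmild, hWdiv, hnorm, hpt, -⟩ :=
    exists_zoomOut_limit hrate hcont hmild hdiv htk0 fun k => (hxk k).le
  have hbdd := bdd_of_hasTypeITimeDecay hrate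
  -- the limit is invariant under the translations along `e`
  have hWinv : ∀ s < 0, ∀ (y : EuclideanSpace ℝ (Fin 3)) (h : ℝ), W s (y + h • e) = W s y := by
    -- first for `h ≥ 0`... in fact for all `h` at once, by the mean value inequality on the whole line
    intro s hs y h
    have hs' : 0 < -s := neg_pos.2 hs
    -- `‖W(s, y + h e) − W(s, y)‖ ≤ δ |h| ‖e‖ / (−s)` for every `δ > 0`
    have hsmall : ∀ δ : ℝ, 0 < δ → ‖W s (y + h • e) - W s y‖ ≤ δ / (-s) * ‖h‖ := by
      intro δ hδ
      obtain ⟨T, hT⟩ := hdir δ hδ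
      -- eventually `c_k² s < T`
      have hev : ∀ᶠ j in atTop, c (φ j) ^ 2 * s < T := by
        have h1 : Tendsto (fun j => c (φ j) ^ 2 * (-s)) atTop atTop :=
          Tendsto.atTop_mul_const hs' ((tendsto_pow_atTop two_ne_zero).comp (hcinf.comp hφ.tendsto_atTop))
        filter_upwards [h1.eventually (eventually_gt_atTop (-T))] with j hj
        linarith
      -- the zoomed slices are `δ/(−s)`-Lipschitz along `e`
      have hlip : ∀ᶠ j in atTop, ‖c (φ j) • v (c (φ j) ^ 2 * s) (xk (φ j) + c (φ j) • (y + h • e)) -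
          c (φ j) • v (c (φ j) ^ 2 * s) (xk (φ j) + c (φ j) • y)‖ ≤ δ / (-s) * ‖h‖ := by
        filter_upwards [hev] with j hj
        set σ : ℝ := c (φ j) ^ 2 * s with hσdef
        have hσ0 : σ < 0 := mul_neg_of_pos_of_neg (pow_pos (hc0 _) 2) hs
        have hVd : Differentiable ℝ (v σ) :=
          ((analyticOnNhd_slice hcont hbdd hmild hσ0).contDiff (n := 1)).differentiable one_ne_zero
        -- the zoomed slice `F`, the path `g τ = F(y + τ e)` and its derivative
        set F : EuclideanSpace ℝ (Fin 3) → EuclideanSpace ℝ (Fin 3) :=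
          fun w => c (φ j) • v σ (xk (φ j) + c (φ j) • w) with hFdef
        set g : ℝ → EuclideanSpace ℝ (Fin 3) := fun τ => F (y + τ • e) with hgdef
        have hwd0 : Differentiable ℝ (fun w : EuclideanSpace ℝ (Fin 3) => v σ (xk (φ j) + c (φ j) • w)) :=
          fun w => (hVd (xk (φ j) + c (φ j) • w)).comp w ((differentiableAt_id.const_smul (c (φ j))).const_add (xk (φ j)))
        have hwd : Differentiable ℝ F := hwd0.const_smul (c (φ j))
        have hgder : ∀ τ : ℝ, HasDerivAt g (fderiv ℝ F (y + τ • e) e) τ := by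
          intro τ
          have hline : HasDerivAt (fun τ : ℝ => y + τ • e) e τ := by
            simpa using ((hasDerivAt_id τ).smul_const e).const_add y
          have hcomp : HasDerivAt (F ∘ fun τ : ℝ => y + τ • e) (fderiv ℝ F (y + τ • e) e) τ :=
            (hwd (y + τ • e)).hasFDerivAt.comp_hasDerivAt τ hline
          exact hcomp
        have hbound : ∀ τ : ℝ, ‖fderiv ℝ F (y + τ • e) e‖ ≤ δ / (-s) := by
          intro τ
          rw [hFdef, fderiv_zoom_apply hVd, norm_smul, Real.norm_of_nonneg (sq_nonneg _)]
          have h1 := hT σ hj (xk (φ j) + c (φ j) • (y + τ • e))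
          have hσs : -σ = c (φ j) ^ 2 * (-s) := by rw [hσdef]; ring
          rw [hσs] at h1
          rw [le_div_iff₀ hs']
          calc c (φ j) ^ 2 * ‖fderiv ℝ (v σ) (xk (φ j) + c (φ j) • (y + τ • e)) e‖ * -s
              = c (φ j) ^ 2 * -s * ‖fderiv ℝ (v σ) (xk (φ j) + c (φ j) • (y + τ • e)) e‖ := by ring
            _ ≤ δ := h1
        have hmv := Convex.norm_image_sub_le_of_norm_hasDerivWithin_le (s := univ) (f := g)
          (fun τ _ => (hgder τ).hasDerivWithinAt) (fun τ _ => hbound τ) convex_univ (mem_univ 0) (mem_univ h)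
        have e0 : g 0 = c (φ j) • v σ (xk (φ j) + c (φ j) • y) := by simp [hgdef, hFdef]
        have eh : g h = c (φ j) • v σ (xk (φ j) + c (φ j) • (y + h • e)) := rfl
        rw [e0, eh, sub_zero, Real.norm_eq_abs] at hmv
        rw [Real.norm_eq_abs]
        exact hmv
      have hlim : Tendsto (fun j => c (φ j) • v (c (φ j) ^ 2 * s) (xk (φ j) + c (φ j) • (y + h • e)) -
          c (φ j) • v (c (φ j) ^ 2 * s) (xk (φ j) + c (φ j) • y)) atTop (𝓝 (W s (y + h • e) - W s y)) :=
        (hpt s hs (y + h • e)).sub (hpt s hs y)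
      exact le_of_tendsto hlim.norm hlip
    have hz : ‖W s (y + h • e) - W s y‖ ≤ 0 := by
      by_contra hpos
      push Not at hpos
      by_cases hh : ‖h‖ = 0
      · have := hsmall 1 one_pos
        rw [hh, mul_zero] at this
        linarith
      · have hhp : 0 < ‖h‖ := lt_of_le_of_ne (norm_nonneg _) (Ne.symm hh)
        have h1 := hsmall (‖W s (y + h • e) - W s y‖ * (-s) / (2 * ‖h‖)) (by positivity)
        have hs0 : s ≠ 0 := hs.ne
        have e1 : ‖W s (y + h • e) - W s y‖ * (-s) / (2 * ‖h‖) / (-s) * ‖h‖ =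
            ‖W s (y + h • e) - W s y‖ / 2 := by
          field_simp
        rw [e1] at h1
        linarith
    exact sub_eq_zero.1 (norm_le_zero_iff.1 hz)
  -- so the limit vanishes — contradiction
  have hW0 := eq_zero_of_translate_eq hWrate hWc hWmild hWdiv he fun t ht y l => hWinv t ht y l
  have h0 : W (-1) 0 = 0 := hW0 (-1) (by norm_num) 0
  rw [h0, norm_zero] at hnorm
  linarith

/-- **THE ONE-DIRECTION DOOR AT `t = −∞` (profiles).** A profile of the route's Type-I class whose scale-invariant
directional derivative `(−t)‖Dv(t)[e]‖_∞` tends to zero as `t → −∞`, for one `e ≠ 0`, vanishes identically. -/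
theorem eq_zero_of_directionalDerivative_tendsto_zero (hrate : HasTypeITimeDecay C v)
    (hcont : ContinuousOn (uncurry v) (Iio (0 : ℝ) ×ˢ univ))
    (hmild : ∀ s t : ℝ, s < t → t < 0 → ∀ x,
      v t x = UnboundedOperators.heatExtension (v s) (t - s) x - oseenDuhamel 1 s v v t x)
    (hdiv : ∀ t < 0, VectorCalculus.IsDivFree (v t)) {e : EuclideanSpace ℝ (Fin 3)} (he : e ≠ 0)
    (hdir : ∀ ε : ℝ, 0 < ε → ∃ T : ℝ, ∀ t < T, ∀ x, (-t) * ‖fderiv ℝ (v t) x e‖ ≤ ε) :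
    ∀ t < 0, ∀ x, v t x = 0 :=
  eq_zero_of_tendsto_zero hrate hcont hmild (tendsto_zero_of_directionalDerivative hrate hcont hmild hdiv he hdir)

/-- The one-direction door at `t = −∞`: not backward-singular. -/
theorem nonflatLiouville_of_directionalDerivative_tendsto_zero (hrate : HasTypeITimeDecay C v)
    (hcont : ContinuousOn (uncurry v) (Iio (0 : ℝ) ×ˢ univ))
    (hmild : ∀ s t : ℝ, s < t → t < 0 → ∀ x,
      v t x = UnboundedOperators.heatExtension (v s) (t - s) x - oseenDuhamel 1 s v v t x)
    (hdiv : ∀ t < 0, VectorCalculus.IsDivFree (v t)) {e : EuclideanSpace ℝ (Fin 3)} (he : e ≠ 0)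
    (hdir : ∀ ε : ℝ, 0 < ε → ∃ T : ℝ, ∀ t < T, ∀ x, (-t) * ‖fderiv ℝ (v t) x e‖ ≤ ε) :
    ¬ IsBackwardSingularPoint v 0 :=
  Summit.NavierStokesRegularity.NavierStokesRegularity.Theorems.PoloidalWindowDoorPoloidalWindowRigidityFlat.not_backwardSingular_of_zero
    (eq_zero_of_directionalDerivative_tendsto_zero hrate hcont hmild hdiv he hdir)

end Summit.NavierStokesRegularity.NavierStokesRegularity.Theorems.PoloidalWindowDoorPoloidalWindowRigidityOneDirectionPast

end
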